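import Summits.HodgeConjecture.HodgeConjecture.Theses.PadicSemiregularLift
import Summits.HodgeConjecture.HodgeConjecture.Theorems.PadicSemiregularLiftFermatAnchorAssemblyDefs
import Summits.HodgeConjecture.HodgeConjecture.Theorems.HodgeFermatVarieties.Negative.DegreeZeroVacuous
import Literature.AlgebraicGeometry.Motives.Jacobian
import Literature.AlgebraicGeometry.Motives.SupersingularAbelianVariety
import Literature.AlgebraicGeometry.Motives.MotivatedPeriodTorsor
import Literature.AlgebraicGeometry.HodgeTheory.FermatHypersurfaceReduction
import Literature.AlgebraicGeometry.HodgeTheory.ComplexConjugationHolds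
import Literature.AlgebraicGeometry.HodgeTheory.FermatHodgeClassesLiftToCurveAndJacobianPowers

/-!
# Crux `FermatAnchorAssembly` (stmt-HodgeConjecture-14874), line `Sketch` (parallelizable-avatar):
# the transfer stub `stub_transfer`, closed MODULO two printed facts (`stub_transfer_of_facts`)

Route `PadicSemiregularLift` of `HodgeConjecture`; skeleton
`Cruxes/FermatAnchorAssembly/Lines/Sketch.lean`, vocabulary
`Theorems/PadicSemiregularLiftFermatAnchorAssemblyDefs.lean` (`HodgeFermatJacobianPowersAt`). The
registered stub

  `stub_transfer : (∀ m C 𝒥, HodgeFermatJacobianPowersAt m C 𝒥) → HodgeFermatVarieties`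

("the Hodge conjecture for all powers `J(C_m)ᴺ⁺¹` of the Jacobians of the complex Fermat curves
`C_m : x₀ᵐ + x₁ᵐ + x₂ᵐ = 0` implies the Hodge conjecture for every complex Fermat hypersurface
`Xⁿₘ : x₀ᵐ + ⋯ + x_{n+1}ᵐ = 0 ⊂ ℙⁿ⁺¹`") is, in print, Shioda–Katsura's domination of `Xⁿₘ` by the
`n`-fold product `C_mⁿ` (Tohoku Math. J. 31 (1979) §1: the rational map `Xʳₘ × Xˢₘ ⇢ X^{r+s}ₘ` of
degree `m`, resolved by one blow-up along `X^{r-1}ₘ × X^{s-1}ₘ`; Shioda, Math. Ann. 245 (1979)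
Thm. I: the induced isomorphism of Hodge structures on primitive cohomology, given by algebraic
correspondences), followed by the Abel–Jacobi embedding `C_mⁿ ↪ J(C_m)ⁿ` (`H*(Jⁿ, ℚ) ↠ H*(Cⁿ, ℚ)`)
and the semisimplicity of polarisable `ℚ`-Hodge structures (Hodge classes lift along surjections).
None of these correspondences exists on the tree's real carriers (`complexBetti`,
`IsRationalClass`, `IsOfHodgeType`, `algebraicClasses`; the tree has pull-backs `complexBetti.map`
and algebraicity of pull-backs only for FLAT maps, `map_mem_algebraicClasses_of_flat`), so the stub
is landed here in CONDITIONAL form, following the lead's NEED-A-PUBLISHED-FACT protocol: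

* `FermatHodgeClassesLiftToCurvePowers` — [ShiodaKatsura1979 §1 + Shioda1979HodgeFermat Thm. I,
  Hodge-class form]: for `m, n ≥ 1` and every `p` there is a `ℂ`-linear
  `F : H²ᵖ(C_mⁿ(ℂ); ℂ) → H²ᵖ(Xⁿₘ(ℂ); ℂ)` (standard models `fermatHypersurface 1 m`,
  `fermatHypersurface n m`; `C_mⁿ = (fermatHypersurface 1 m).pow n`, the tree's cartesian power
  `Motives.SchemeOver.pow`) carrying algebraic classes to algebraic classes, such that every
  rational `(p,p)`-class on `Xⁿₘ` is `F a` for a rational `(p,p)`-class `a` on `C_mⁿ`;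
* `CurvePowerHodgeClassesLiftToJacobianPowers` — [Abel–Jacobi; Lange 2023 §4.1.1 / Lemma 4.4.1,
  Milne 1986 Thm. 2.5, Voisin 2025 Cor. 2.12, Fulton 1998 Cor. 19.2]: for a smooth projective
  complex curve `C`, a Jacobian `𝒥` of `C` (`Motives.Jacobian`) and all `N, p`, there is a
  `ℂ`-linear `G : H²ᵖ(Jᴺ⁺¹(ℂ); ℂ) → H²ᵖ(Cᴺ⁺¹(ℂ); ℂ)` (`Jᴺ⁺¹ = (𝒥.J.powSucc N).X`,
  `Cᴺ⁺¹ = C.pow (N + 1)`) carrying algebraic classes to algebraic classes, such that every rational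
  `(p,p)`-class on `Cᴺ⁺¹` is, MODULO ALGEBRAIC CLASSES, `G b` for a rational `(p,p)`-class `b` on
  `Jᴺ⁺¹` (for genus `≥ 1` exactly `G b`, `G = (AJᴺ⁺¹)^*`; for genus `0`, `C ≅ ℙ¹`, every class of
  `(ℙ¹)ᴺ⁺¹` is algebraic);
* the EXISTING Literature named fact `Motives.nonempty_jacobian_of_isSmoothProjective` (Milne 1986,
  Thm. 1.1: smooth projective curves have Jacobians), needed to instantiate the hypothesis at the
  Fermat curve at all.

`stub_transfer_of_facts` then PROVES
`FermatHodgeClassesLiftToCurvePowers → Literature.AlgebraicGeometry.HodgeTheory.CurvePowerHodgeClassesLiftToJacobianPowers →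
nonempty_jacobian_of_isSmoothProjective → (∀ m C 𝒥, HodgeFermatJacobianPowersAt m C 𝒥) →
HodgeFermatVarieties` from the tree: `m = 0` is vacuous (`degree_zero_vacuous`: `V₊(n+2) = ∅` is
not geometrically irreducible); `n = 0` is unconditional
(`hodgeClasses_algebraic_fermat_of_dim_le_one`); Hodge models exist (`nonempty_hodgeModel_holds`);
an arbitrary `X` with `IsFermatVariety n m X ∧ IsSmoothProjective n X` is transported to the
standard model along `IsFermatVariety.isoFermatHypersurface` (`IsOfHodgeType.map_of_iso`,
`IsRationalClass.map`, `mem_algebraicClasses_map_of_iso`, the pattern of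
`hodgeClasses_algebraic_fermat_middle_of_fermatHypersurface`); and on the standard model
(`mem_algebraicClasses_fermatHypersurface_of_facts`, `n = N + 1`): a rational `(p,p)`-class `c` is
`F a`, `a` is `G b + (algebraic)`, `b` is algebraic by the hypothesis at
`(m, fermatHypersurface 1 m, 𝒥, N)`, hence so are `G b`, `a`, `c`. So
`stub_transfer = stub_transfer_of_facts hSK hAJ hJ` once the two facts and Milne's existence theorem
are discharged; the lead re-registers them as stubs of the skeleton.

Small / junk cases, analysed: `m = 0` contradictory (above); `m = 1` (`Xⁿ₁` a hyperplane `≅ ℙⁿ`,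
`C₁` a line) and `m = 2` (quadric, conic): the Fermat curve has genus `0`, its Jacobians are
zero-dimensional, the hypothesis is void there, and the two facts carry the (classical) content —
all of `H*((ℙ¹)ⁿ)` is algebraic and `Xⁿₘ`, `m ≤ 2`, is dominated by it; `n = 0` (`X⁰ₘ` = `m` points,
geometrically irreducible only for `m = 1`) is settled by `algebraicClasses_eq_top_of_eq_zero_or_le`
whatever `m`. Both facts are true for all values of their quantifiers (`p = 0`: `algebraicClasses _ 0
= ⊤`; `2p > 2·dim`: both sides vanish); `1 ≤ n` in the first is necessary (`X⁰ₘ` has `m`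
components, `C_m⁰ = Spec ℂ` one).
-/

-- `Summit.HodgeConjecture.HodgeConjecture.…` is the tree's mandated summit/problem namespace (single-problem summit).
set_option linter.dupNamespace false

noncomputable section

open CategoryTheory AlgebraicGeometry
open Literature.AlgebraicGeometry Literature.AlgebraicGeometry.Motives
  Literature.AlgebraicGeometry.HodgeTheory
open Literature.AlgebraicTopology.SingularHomology

namespace Summit.HodgeConjecture.HodgeConjecture.Cruxes.FermatAnchorAssembly.ParallelizableAvatar

/-! ## The two printed facts (NEED-A-PUBLISHED-FACT; the gate relocates them to `Literature/`) -/

/-- **The kernel on the standard model.** Granted the two facts, the existence of Jacobians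
(Milne Thm. 1.1, `Motives.nonempty_jacobian_of_isSmoothProjective`) and the hypothesis of the stub
(HC for all powers of all Jacobians of all smooth projective Fermat curves), every rational
`(p,p)`-class on the standard Fermat variety `V₊(Σᵢ xᵢᵐ) ⊂ ℙⁿ⁺¹_ℂ`, `m, n ≥ 1`, is algebraic:
write `n = N + 1`; `c = F a` with `a` rational `(p,p)` on `C_mⁿ` (first fact); `a - G b` is
algebraic with `b` rational `(p,p)` on `J(C_m)ⁿ = (𝒥.J.powSucc N).X` (second fact, `𝒥` a Jacobian
of `C_m = fermatHypersurface 1 m`, which is a smooth projective Fermat curve: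
`isSmoothProjective_fermatHypersurface`, `isFermatVariety_fermatHypersurface`); `b` is algebraic by
the hypothesis at `(m, C_m, 𝒥, N)`; hence `G b`, `a = (a - G b) + G b` and `c = F a` are algebraic.
[cite: ShiodaKatsura1979, §1 Thm. 1.7] [cite: Shioda1979HodgeFermat, Thm. I] -/
theorem mem_algebraicClasses_fermatHypersurface_of_facts (hSK : Literature.AlgebraicGeometry.HodgeTheory.FermatHodgeClassesLiftToCurvePowers)
    (hAJ : Literature.AlgebraicGeometry.HodgeTheory.CurvePowerHodgeClassesLiftToJacobianPowers) (hJ : nonempty_jacobian_of_isSmoothProjective.{0})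
    (H : ∀ (m : ℕ) (C : SchemeOver ℂ) (𝒥 : Jacobian C), HodgeFermatJacobianPowersAt m C 𝒥)
    {m n : ℕ} (hm : 1 ≤ m) (hn : 1 ≤ n) (p : ℕ) (c : complexBetti (fermatHypersurface n m) (2 * p))
    (hc : IsRationalClass c) (hpp : IsOfHodgeType n (fermatHypersurface n m) (2 * p) p p c) :
    c ∈ algebraicClasses (fermatHypersurface n m) p := by
  obtain ⟨N, rfl⟩ : ∃ N, n = N + 1 := ⟨n - 1, by omega⟩
  have hC : IsSmoothProjective 1 (fermatHypersurface 1 m) :=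
    isSmoothProjective_fermatHypersurface le_rfl hm
  have hCF : IsFermatVariety 1 m (fermatHypersurface 1 m) := isFermatVariety_fermatHypersurface hm
  obtain ⟨𝒥⟩ := hJ ℂ (fermatHypersurface 1 m) hC
  have HJ : HodgeConjectureFor (𝒥.J.powSucc N).dim (𝒥.J.powSucc N).X := H m _ 𝒥 hCF hC N
  obtain ⟨F, hFalg, hFlift⟩ := hSK m (N + 1) p hm (Nat.succ_pos N)
  obtain ⟨a, harat, happ, rfl⟩ := hFlift c hc hpp
  refine hFalg a ?_
  obtain ⟨G, hGalg, hGlift⟩ := hAJ (fermatHypersurface 1 m) hC 𝒥 N p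
  obtain ⟨b, hbrat, hbpp, hdiff⟩ := hGlift a harat happ
  have hb : b ∈ algebraicClasses (𝒥.J.powSucc N).X p := HJ.2 p b hbrat hbpp
  have hGb : G b ∈ algebraicClasses ((fermatHypersurface 1 m).pow (N + 1)) p := hGalg b hb
  have := Submodule.add_mem _ hdiff hGb
  rwa [sub_add_cancel] at this

/-- **Registered sub-goal `stub_transfer_of_facts`: the transfer stub modulo the two printed facts
and Milne's existence theorem.** From `FermatHodgeClassesLiftToCurvePowers` (Shioda–Katsura §1 /
Shioda Thm. I, Hodge-class form), `CurvePowerHodgeClassesLiftToJacobianPowers` (Abel–Jacobi) and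
`Motives.nonempty_jacobian_of_isSmoothProjective` (Milne Thm. 1.1), the Hodge conjecture for all
powers of the Fermat Jacobians implies `HodgeFermatVarieties` (HC for every smooth projective
complex Fermat hypersurface, all `n`, `m`). Proof: the anti-vacuity conjunct is
`nonempty_hodgeModel_holds`; `m = 0` is contradictory (`degree_zero_vacuous`); `n = 0` is
`hodgeClasses_algebraic_fermat_of_dim_le_one`; otherwise transport the class to the standard model
along `e = IsFermatVariety.isoFermatHypersurface : X ≅ V₊(Σ xᵢᵐ)` (`(e⁻¹)^* c` is rational and of
type `(p,p)` by `IsRationalClass.map`, `IsOfHodgeType.map_of_iso`), apply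
`mem_algebraicClasses_fermatHypersurface_of_facts`, and come back with
`mem_algebraicClasses_map_of_iso` and `e^*(e⁻¹)^* c = c`. Hence
`stub_transfer = stub_transfer_of_facts hSK hAJ hJ`.
[cite: ShiodaKatsura1979, §1 Thm. 1.7] [cite: Shioda1979HodgeFermat, Thm. I]
[cite: Milne1986JacobianVarieties, Thm. 1.1 and §6 Prop. 6.4] -/
theorem stub_transfer_of_facts : Literature.AlgebraicGeometry.HodgeTheory.FermatHodgeClassesLiftToCurvePowers → Literature.AlgebraicGeometry.HodgeTheory.CurvePowerHodgeClassesLiftToJacobianPowers → nonempty_jacobian_of_isSmoothProjective.{0} → (∀ (m : ℕ) (C : SchemeOver ℂ) (𝒥 : Jacobian C), HodgeFermatJacobianPowersAt m C 𝒥) → Theses.PadicSemiregularLift.HodgeFermatVarieties := by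
  intro hSK hAJ hJ H n m X hF hX
  refine ⟨nonempty_hodgeModel_holds hX, fun p c hc hpp => ?_⟩
  rcases Nat.eq_zero_or_pos m with rfl | hm
  · exact (Summit.HodgeConjecture.HodgeConjecture.Theorems.HodgeFermatVarietiesNegative.degree_zero_vacuous
      hF hX).elim
  rcases Nat.eq_zero_or_pos n with rfl | hn
  · exact hodgeClasses_algebraic_fermat_of_dim_le_one (by omega) hX p c
  -- transport to the standard model `V₊(Σ xᵢᵐ)`
  have hX' : IsSmoothProjective n (fermatHypersurface n m) := isSmoothProjective_fermatHypersurface hn hm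
  let e : X ≅ fermatHypersurface n m := hF.isoFermatHypersurface
  set c' : complexBetti (fermatHypersurface n m) (2 * p) :=
    singularCohomology.map ℂ ℂ (Motives.AlgPoints.mapContinuous (L := ℂ) e.inv) (2 * p) c with hc'
  have hc'rat : IsRationalClass c' := hc.map _
  have hc'pp : IsOfHodgeType n (fermatHypersurface n m) (2 * p) p p c' := hpp.map_of_iso e.symm
  have hc'alg : c' ∈ algebraicClasses (fermatHypersurface n m) p :=
    mem_algebraicClasses_fermatHypersurface_of_facts hSK hAJ hJ H hm hn p c' hc'rat hc'pp
  have := mem_algebraicClasses_map_of_iso hX' hX e hc'alg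
  rwa [hc', show complexBetti.map e.hom (2 * p)
      (singularCohomology.map ℂ ℂ (Motives.AlgPoints.mapContinuous (L := ℂ) e.inv) (2 * p) c) = c from
    map_hom_map_inv_apply e (2 * p) c] at this

end Summit.HodgeConjecture.HodgeConjecture.Cruxes.FermatAnchorAssembly.ParallelizableAvatar

end
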